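import Summits.ResolutionOfSingularities.ResolutionOfSingularities.Theorems.WeightedInvariantWeightedThesisHypersurfaceChoiceTAtlas
import Summits.ResolutionOfSingularities.ResolutionOfSingularities.Theorems.WeightedInvariantWeightedThesisHypersurfaceChoiceDimTower
import HarnessLib

/-!
# Crux `WeightedThesis` (stmt-ResolutionOfSingularities-0569): TOWER-TYPED choices in every transversal dimension suffice

Topic: `Summits/ResolutionOfSingularities/ResolutionOfSingularities/Theorems`. Route
`ResolutionOfSingularities/WeightedInvariant`, crux `Theses.WeightedInvariant.WeightedThesis`, line
`datum-glued-split`, lead c9, RESHAPE 10 — the tower and the composition for the ladder with tower-typed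
homogeneity `HypersurfaceCentreChoiceTDim p e` (`Theorems/…HypersurfaceChoiceT.lean`: `(H_T)` =
homogeneity only on the TOWER charts `HypersurfacePair.IsTowerChart centre P j W 𝒢`).

The ladder tower of RESHAPE 9 (`HypersurfaceChoiceDimTower.hasResolution_quotient_of_gradedAtlas`) is
re-run with one more induction invariant: every chart of the graded atlas at hand is a tower chart of
`centre` (`∀ a, IsTowerChart centre P j (𝒜.W a) (𝒜.piece a)`). It holds at the start (rank `0`: the
grading by `ℤ⁰` is trivial, `hyp_mem_of_gradedRing_fin_zero`, `IsTowerChart.start`) and is propagated by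
the tower-typed quotient step (`DatumToEmbedded.quotientStep_towerTyped`: each new chart is a
`TowerChartStep` over an old one, `IsTowerChart.step`); under it, `(H_T)` supplies exactly the homogeneity
the quotient step reads.

* `HypersurfaceChoiceTTower.hasResolution_quotient_of_gradedAtlas` — the tower;
* `HypersurfaceChoiceTTower.hasResolution_hypersurface_of_choiceTDim_field`,
  `HypersurfaceChoiceTTower.hasResolution_of_choiceTDim_field`,
  `HypersurfaceChoiceTTower.resolution_field_iff_berghRydh_field_of_choiceTDim` — field-wise corollaries;
* `weightedThesis_of_hypersurfaceChoiceTDim_of_forall_berghRydh_charP` (registered stub of the line,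
  RESHAPE 10) — **`(∀ p prime, ∀ e, Nonempty (HypersurfaceCentreChoiceTDim p e))` and the characteristic-`p`
  instances of Bergh–Rydh give `WeightedThesis`**; the RESHAPE 9 ladder composition factors through it
  (`HypersurfaceCentreChoiceTDim.ofChoiceDim`).
-/

noncomputable section

open CategoryTheory CategoryTheory.Limits AlgebraicGeometry TopologicalSpace
open Literature.AlgebraicGeometry.Resolution
open Summit.ResolutionOfSingularities.ResolutionOfSingularities.Theses.WeightedInvariant
open Summit.ResolutionOfSingularities.ResolutionOfSingularities.Theorems

set_option linter.dupNamespace false -- mandated namespace of this single-conjunct summit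

/-! ## The tower with the tower-chart invariant -/

namespace Summit.ResolutionOfSingularities.ResolutionOfSingularities.Theorems.HypersurfaceChoiceTTower

/-- **Every torus-quotient presentation BY TOWER CHARTS of an integral hypersurface of `Y/k` reached in
transversal dimension `e` has a resolved quotient, granted a tower-typed choice in transversal dimension `e`
at `p = char k` and Bergh–Rydh over `k`**: well-founded induction on `ReachDim e P ∧ Step P' P` (property
`(T)`), motive guarded by `ReachDim e P` AND by "every chart of the atlas is a tower chart of `centre`".
Base (`X` regular): quotient singularities and Bergh–Rydh. Step: `(iii)`, `(ii')` from the guard; `(H_T)` on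
the charts of the atlas, which are tower charts; the tower-typed quotient step
(`DatumToEmbedded.quotientStep_towerTyped`) returns the successor atlas together with the certificate that
its charts are `TowerChartStep`s over the old ones, so they are tower charts of the successor pair
(`IsTowerChart.step`), which is `Step`-below and reached (`ReachDim.step`): the induction hypothesis
resolves the new quotient, and the old one along the blow-up.
[cite: Wlodarczyk2022, Thm 1.1.4 (5), Thm 1.1.6; BerghRydh2019, Thm 5] -/
theorem hasResolution_quotient_of_gradedAtlas
    {p e : ℕ} (C : HypersurfaceCentreChoiceTDim p e) {k : Type} [Field k] [CharP k p] [PerfectField k]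
    (hBR : ∀ (V : Scheme.{0}) (g : V ⟶ Spec (.of k)) [IsIntegral V] [IsSeparated g]
      [LocallyOfFiniteType g] [QuasiCompact g],
      (∀ v : V, ∃ (A : Type) (_ : AddCommGroup A) (_ : Finite A) (_ : DecidableEq A)
        (S : Type) (_ : CommRing S) (_ : Algebra k S) (𝒮 : A → Submodule k S)
        (_ : GradedAlgebra 𝒮), Algebra.FiniteType k S ∧ Algebra.Smooth k S ∧
        ∃ φ : Spec (.of (𝒮 0)) ⟶ V, Etale φ ∧ v ∈ Set.range φ ∧
          φ ≫ g = Spec.map (CommRingCat.ofHom (algebraMap k (𝒮 0)))) →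
      Scheme.HasResolution V)
    (P : HypersurfacePair k) :
    HypersurfacePair.ReachDim (fun ⦃Y : Scheme.{0}⦄ (f : Y ⟶ Spec (.of k)) X => C.centre f X) e P →
    ∀ (X V : Scheme.{0}) (i : X ⟶ P.Y) [IsClosedImmersion i] [IsIntegral X], i.ker = P.X →
      ∀ (g : V ⟶ Spec (.of k)) [IsSeparated g] [LocallyOfFiniteType g] [QuasiCompact g]
        [IsIntegral V] (q : X ⟶ V), q ≫ g = i ≫ P.f → ∀ (j : ℕ) (𝒜 : GradedAtlas j P.f i q),
        (∀ a : 𝒜.ι, HypersurfacePair.IsTowerChart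
          (fun ⦃Y : Scheme.{0}⦄ (f : Y ⟶ Spec (.of k)) X => C.centre f X) P j (𝒜.W a) (𝒜.piece a)) →
        Scheme.HasResolution V := by
  refine (C.wellFounded_step (k := k)).induction
    (C := fun P : HypersurfacePair k =>
      HypersurfacePair.ReachDim (fun ⦃Y : Scheme.{0}⦄ (f : Y ⟶ Spec (.of k)) X => C.centre f X) e P →
      ∀ (X V : Scheme.{0}) (i : X ⟶ P.Y) [IsClosedImmersion i] [IsIntegral X], i.ker = P.X →
        ∀ (g : V ⟶ Spec (.of k)) [IsSeparated g] [LocallyOfFiniteType g] [QuasiCompact g]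
          [IsIntegral V] (q : X ⟶ V), q ≫ g = i ≫ P.f → ∀ (j : ℕ) (𝒜 : GradedAtlas j P.f i q),
          (∀ a : 𝒜.ι, HypersurfacePair.IsTowerChart
            (fun ⦃Y : Scheme.{0}⦄ (f : Y ⟶ Spec (.of k)) X => C.centre f X) P j (𝒜.W a)
              (𝒜.piece a)) →
          Scheme.HasResolution V) P ?_
  intro P ih hreach
  obtain ⟨Y, f, I, hI, hIi⟩ := P
  dsimp only
  intro X V i _ _ hIeq g _ _ _ _ q hq j 𝒜 h𝒜
  subst hIeq
  by_cases hreg : Scheme.IsRegular X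
  · -- base: `X` regular ⇒ quotient singularities ⇒ Bergh–Rydh over `k`
    exact hBR V g (DatumToEmbedded.quotientSingularities_of_regular f i q g hq hreg 𝒜)
  · -- step
    have hsing : ¬ Scheme.IsRegular i.ker.subscheme := fun h =>
      hreg ((isRegular_iff_isRegular_image i).mpr h)
    haveI : IsLocallyNoetherian Y := LocallyOfFiniteType.isLocallyNoetherian f
    have hY : Scheme.IsRegular Y := Scheme.IsRegular.of_smooth f (Scheme.isRegular_Spec (.of k))
    -- the current pair, reached in transversal dimension `e`, presented by tower charts
    let P : HypersurfacePair k :=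
      @HypersurfacePair.mk k _ Y f inferInstance inferInstance inferInstance i.ker hI hIi
    have hreachP : HypersurfacePair.ReachDim
        (fun ⦃Y : Scheme.{0}⦄ (f : Y ⟶ Spec (.of k)) X => C.centre f X) e P := hreach
    have h𝒜P : ∀ a : 𝒜.ι, HypersurfacePair.IsTowerChart
        (fun ⦃Y : Scheme.{0}⦄ (f : Y ⟶ Spec (.of k)) X => C.centre f X) P j (𝒜.W a) (𝒜.piece a) :=
      h𝒜
    -- the guard releases `(iii)`, `(ii')`: a regular weighted centre off the generic point of `X`
    have hc : (C.centre f i.ker).IsRegularWeightedCentre :=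
      C.isRegularWeightedCentre_centre P hreachP hsing
    have hξ : i (genericPoint X) ∉ (C.centre f i.ker).support :=
      C.genericPoint_not_mem_support_centre f i hI hreachP hreg
    -- the Rees filtration of the centre
    let R' : ReesFiltration Y :=
      { ideal := (C.centre f i.ker).piece
        ideal_zero := (C.centre f i.ker).piece_zero
        antitone := antitone_piece hc
        mul_le := (C.centre f i.ker).piece_mul_le }
    -- the new ambient is smooth separated quasi-compact
    obtain ⟨hsm', hsep', hqc'⟩ :=
      WeightedThesis.GlobalCobordantPlus.smooth_πPlus_comp_of_isRegularWeightedCentre f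
        (C.centre f i.ker) hc R' rfl
    haveI := hsm'; haveI := hsep'; haveI := hqc'
    -- the strict transform is integral and lies over `X`
    obtain ⟨hint', hker⟩ :=
      DatumToEmbedded.StrictTransform.isIntegral_strictTransformPlus_of_not_mem_support i
        (C.centre f i.ker) hc R' rfl hξ
    haveI := hint'
    -- the successor pair is a hypersurface pair
    have hI'lp : IsLocallyPrincipal (R'.strictTransformPlus i.ker) :=
      WeightedThesis.HypersurfacePreserved.isLocallyPrincipal_strictTransformPlus hY
        (C.centre f i.ker) hc R' rfl i.ker hI
    have hI'i : IsIntegral (R'.strictTransformPlus i.ker).subscheme := hint'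
    let i' := (R'.strictTransformPlus i.ker).subschemeι
    let σX : (R'.strictTransformPlus i.ker).subscheme ⟶ X :=
      IsClosedImmersion.lift i (i' ≫ R'.πPlus) hker
    have hσX : σX ≫ i = i' ≫ R'.πPlus := IsClosedImmersion.lift_fac _ _ _
    -- `(H_T)`: homogeneity of the chosen centre on the TOWER charts of the presentation
    have hhom := fun (a : 𝒜.ι) (n : ℕ) =>
      @HypersurfaceCentreChoiceTDim.centre_isHomogeneous_towerChart p e C k _ _ _ P hreachP hsing j
        (𝒜.W a) (𝒜.piece a) (𝒜.gradedRing a) (h𝒜P a) (𝒜.isHomogeneous_ker a) n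
    -- the tower-typed quotient step
    obtain ⟨K, hK, hstep⟩ := DatumToEmbedded.quotientStep_towerTyped f i q g hq 𝒜
      (C.centre f i.ker) hc hξ hhom R' rfl σX hσX
    -- blow `V` up along `K`
    obtain ⟨V', ρ, hρ⟩ := exists_isBlowup V K
    haveI : IsLocallyNoetherian V := LocallyOfFiniteType.isLocallyNoetherian g
    haveI : IsProper ρ := hρ.isProper
    have hbir : IsBirational ρ := hρ.isBirational' hK
    haveI : IsIntegral V' := hρ.isIntegral hK
    obtain ⟨q', hq', 𝒜', h𝒜'⟩ := hstep V' ρ hρ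
    -- the successor pair is a step below the current one, reached, and presented by tower charts
    let P' : HypersurfacePair k := P.succ R' hsm' hsep' hqc' hI'lp hI'i
    have hlt : HypersurfacePair.Step (fun ⦃Y : Scheme.{0}⦄ (f : Y ⟶ Spec (.of k)) X => C.centre f X)
        P' P :=
      HypersurfacePair.Step.intro P hsing R' rfl hsm' hsep' hqc' hI'lp hI'i
    have hreach' : HypersurfacePair.ReachDim
        (fun ⦃Y : Scheme.{0}⦄ (f : Y ⟶ Spec (.of k)) X => C.centre f X) e P' := hreachP.step hlt
    have h𝒜'T : ∀ b : 𝒜'.ι, HypersurfacePair.IsTowerChart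
        (fun ⦃Y : Scheme.{0}⦄ (f : Y ⟶ Spec (.of k)) X => C.centre f X) P' (j + 1) (𝒜'.W b)
          (𝒜'.piece b) := by
      intro b
      obtain ⟨a, hab⟩ := h𝒜' b
      exact HypersurfacePair.IsTowerChart.step (h𝒜P a) hsing R' rfl hsm' hsep' hqc' hI'lp hI'i
        (𝒜'.W b) (𝒜'.piece b) hab
    have hV' : Scheme.HasResolution V' := by
      have hQ' := ih P' ⟨hreachP, hlt⟩ hreach'
      refine hQ' (R'.strictTransformPlus i.ker).subscheme V' i'
        (Scheme.IdealSheafData.ker_subschemeι _) (ρ ≫ g) q' ?_ (j + 1) 𝒜' h𝒜'T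
      change q' ≫ ρ ≫ g = i' ≫ R'.πPlus ≫ f
      rw [← Category.assoc, hq', Category.assoc, hq, ← Category.assoc, hσX, Category.assoc]
    exact Scheme.HasResolution.of_isBirational ρ hbir hV'

/-! ## Tower-typed choices in every transversal dimension + Bergh–Rydh over `k` ⇒ resolution over `k` -/

/-- **Tower-typed hypersurface centre choices in every transversal dimension (in characteristic `p`) and
Bergh–Rydh over the perfect field `k` of characteristic `p` resolve every integral HYPERSURFACE of every
smooth separated quasi-compact `k`-scheme**: start the tower in transversal dimension `e = dim V(ker i)`
on the trivial presentation of rank `0`, whose charts carry the trivial `ℤ⁰`-grading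
(`hyp_mem_of_gradedRing_fin_zero`) and are therefore tower charts (`IsTowerChart.start`).
[cite: Wlodarczyk2022, Thm 1.1.6; BerghRydh2019, Thm 5] -/
theorem hasResolution_hypersurface_of_choiceTDim_field
    {p : ℕ} (C : ∀ e : ℕ, HypersurfaceCentreChoiceTDim p e) {k : Type} [Field k] [CharP k p]
    [PerfectField k]
    (hBR : ∀ (V : Scheme.{0}) (g : V ⟶ Spec (.of k)) [IsIntegral V] [IsSeparated g]
      [LocallyOfFiniteType g] [QuasiCompact g],
      (∀ v : V, ∃ (A : Type) (_ : AddCommGroup A) (_ : Finite A) (_ : DecidableEq A)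
        (S : Type) (_ : CommRing S) (_ : Algebra k S) (𝒮 : A → Submodule k S)
        (_ : GradedAlgebra 𝒮), Algebra.FiniteType k S ∧ Algebra.Smooth k S ∧
        ∃ φ : Spec (.of (𝒮 0)) ⟶ V, Etale φ ∧ v ∈ Set.range φ ∧
          φ ≫ g = Spec.map (CommRingCat.ofHom (algebraMap k (𝒮 0)))) →
      Scheme.HasResolution V)
    {Y X : Scheme.{0}} (f : Y ⟶ Spec (.of k)) [Smooth f] [IsSeparated f] [QuasiCompact f]
    (i : X ⟶ Y) [IsClosedImmersion i] [IsIntegral X] (hX : IsLocallyPrincipal i.ker) :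
    Scheme.HasResolution X := by
  obtain ⟨𝒜₀⟩ := DatumToEmbedded.InitialAtlas.stub_initialAtlas f i
  haveI : IsSeparated (i ≫ f) := inferInstance
  haveI : LocallyOfFiniteType (i ≫ f) := inferInstance
  haveI : QuasiCompact (i ≫ f) := inferInstance
  obtain ⟨e, he⟩ := hyp_exists_nat_topologicalKrullDim_ker_subscheme f i
  refine hasResolution_quotient_of_gradedAtlas (C e) hBR (HypersurfacePair.ofKer f i hX)
    (HypersurfacePair.ReachDim.start he) X X i rfl (i ≫ f) (𝟙 X) (Category.id_comp _) 0 𝒜₀ ?_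
  intro a
  exact HypersurfacePair.IsTowerChart.start (HypersurfacePair.ofKer f i hX) (𝒜₀.W a) (𝒜₀.piece a)
    (fun v x => @hyp_mem_of_gradedRing_fin_zero _ _ (𝒜₀.piece a) (𝒜₀.gradedRing a) v x)

/-- **Tower-typed choices in every transversal dimension and Bergh–Rydh over the perfect field `k` of
characteristic `p` resolve every reduced separated `k`-scheme of finite type** (hypersurface reduction of
the line, `HypersurfacesIff.hasResolution_of_hypersurfaces`).
[cite: Wlodarczyk2022, Thm 1.1.6; BerghRydh2019, Thm 5; Kollar2007, Prop. 2.48 (proof)] -/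
theorem hasResolution_of_choiceTDim_field
    {p : ℕ} (hp : p.Prime) (C : ∀ e : ℕ, HypersurfaceCentreChoiceTDim p e) {k : Type} [Field k]
    [CharP k p] [PerfectField k]
    (hBR : ∀ (V : Scheme.{0}) (g : V ⟶ Spec (.of k)) [IsIntegral V] [IsSeparated g]
      [LocallyOfFiniteType g] [QuasiCompact g],
      (∀ v : V, ∃ (A : Type) (_ : AddCommGroup A) (_ : Finite A) (_ : DecidableEq A)
        (S : Type) (_ : CommRing S) (_ : Algebra k S) (𝒮 : A → Submodule k S)
        (_ : GradedAlgebra 𝒮), Algebra.FiniteType k S ∧ Algebra.Smooth k S ∧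
        ∃ φ : Spec (.of (𝒮 0)) ⟶ V, Etale φ ∧ v ∈ Set.range φ ∧
          φ ≫ g = Spec.map (CommRingCat.ofHom (algebraMap k (𝒮 0)))) →
      Scheme.HasResolution V)
    (X : Scheme.{0}) (f : X ⟶ Spec (.of k)) [IsSeparated f] [LocallyOfFiniteType f]
    [QuasiCompact f] [IsReduced X] : Scheme.HasResolution X :=
  Summit.ResolutionOfSingularities.ResolutionOfSingularities.Theorems.WeightedThesis.HypersurfacesIff.hasResolution_of_hypersurfaces hp k
    (fun Y H g j hg hs hq hj hint hpr => by
      haveI := hg; haveI := hs; haveI := hq; haveI := hj; haveI := hint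
      exact hasResolution_hypersurface_of_choiceTDim_field C hBR g j
        (isLocallyPrincipal_of_forall_isPrincipal hpr)) X f

/-- **The field-wise residue of the crux with tower-typed choices in every transversal dimension.** Over a
perfect field `k` of characteristic `p` carrying `C e : HypersurfaceCentreChoiceTDim p e` for every `e`,
resolution of every reduced separated `k`-scheme of finite type is EQUIVALENT to Bergh–Rydh over `k`.
[cite: Wlodarczyk2022, Thm 1.1.6; BerghRydh2019, Thm 5] -/
theorem resolution_field_iff_berghRydh_field_of_choiceTDim
    {p : ℕ} (hp : p.Prime) (C : ∀ e : ℕ, HypersurfaceCentreChoiceTDim p e) (k : Type) [Field k]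
    [CharP k p] [PerfectField k] :
    (∀ (X : Scheme.{0}) (f : X ⟶ Spec (.of k)), IsSeparated f → LocallyOfFiniteType f →
      QuasiCompact f → IsReduced X → Scheme.HasResolution X) ↔
    ∀ (V : Scheme.{0}) (g : V ⟶ Spec (.of k)) [IsIntegral V] [IsSeparated g]
      [LocallyOfFiniteType g] [QuasiCompact g],
      (∀ v : V, ∃ (A : Type) (_ : AddCommGroup A) (_ : Finite A) (_ : DecidableEq A)
        (S : Type) (_ : CommRing S) (_ : Algebra k S) (𝒮 : A → Submodule k S)
        (_ : GradedAlgebra 𝒮), Algebra.FiniteType k S ∧ Algebra.Smooth k S ∧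
        ∃ φ : Spec (.of (𝒮 0)) ⟶ V, Etale φ ∧ v ∈ Set.range φ ∧
          φ ≫ g = Spec.map (CommRingCat.ofHom (algebraMap k (𝒮 0)))) →
      Scheme.HasResolution V :=
  ⟨Summit.ResolutionOfSingularities.ResolutionOfSingularities.Theorems.WeightedThesis.BerghRydhCharP.berghRydh_field_of_resolution_field,
    fun hBR X f hs hl hq hr => by
    haveI := hs; haveI := hl; haveI := hq; haveI := hr
    exact hasResolution_of_choiceTDim_field hp C hBR X f⟩

end Summit.ResolutionOfSingularities.ResolutionOfSingularities.Theorems.HypersurfaceChoiceTTower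

namespace Summit.ResolutionOfSingularities.ResolutionOfSingularities.Theorems

/-! ## The crux from tower-typed choices in every transversal dimension and prime-wise Bergh–Rydh -/

/-- **`WeightedThesis` from TOWER-TYPED hypersurface centre choices in every transversal dimension and the
characteristic-`p` instances of Bergh–Rydh** (registered stub of line `datum-glued-split`, RESHAPE 10, crux
stmt-0569): if for every prime `p` and every `e` a tower-typed choice in transversal dimension `e` exists
(`Nonempty (HypersurfaceCentreChoiceTDim p e)`: regular weighted centre, off the generic point, homogeneous
on the TOWER charts of the pair, well-founded tower step — on the pairs reached from dimension-`e` starts;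
implied by RESHAPE 9's rung through `HypersurfaceCentreChoiceTDim.ofChoiceDim`, hence by the choice, the
strategy, the hypersurface datum and `WeightedConstruction`; rung `e = 1` = Abramovich–Quek–Schober
arXiv:2507.01232 Thm 1.1 up to language), and for every prime `p` and every perfect field `k` of
characteristic `p` every integral separated finite-type `k`-scheme with finite diagonalizable quotient
singularities étale-locally has a resolution, then every reduced separated scheme of finite type over every
perfect field of positive characteristic has a resolution.
[cite: Wlodarczyk2022, Thm 1.1.6; BerghRydh2019, Thm 5; AbramovichTemkinWlodarczyk2024, §1.9] -/
theorem weightedThesis_of_hypersurfaceChoiceTDim_of_forall_berghRydh_charP : (∀ p : ℕ, p.Prime → ∀ e : ℕ, Nonempty (Summit.ResolutionOfSingularities.ResolutionOfSingularities.Theorems.HypersurfaceCentreChoiceTDim p e)) → (∀ p : ℕ, p.Prime → ∀ (k : Type) [Field k] [CharP k p] [PerfectField k] (V : AlgebraicGeometry.Scheme.{0}) (g : V ⟶ AlgebraicGeometry.Spec (.of k)) [AlgebraicGeometry.IsIntegral V] [AlgebraicGeometry.IsSeparated g] [AlgebraicGeometry.LocallyOfFiniteType g] [AlgebraicGeometry.QuasiCompact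 g], (∀ v : V, ∃ (A : Type) (_ : AddCommGroup A) (_ : Finite A) (_ : DecidableEq A) (S : Type) (_ : CommRing S) (_ : Algebra k S) (𝒮 : A → Submodule k S) (_ : GradedAlgebra 𝒮), Algebra.FiniteType k S ∧ Algebra.Smooth k S ∧ ∃ φ : AlgebraicGeometry.Spec (.of (𝒮 0)) ⟶ V, AlgebraicGeometry.Etale φ ∧ v ∈ Set.range φ ∧ φ ≫ g = AlgebraicGeometry.Spec.map (CommRingCat.ofHom (algebraMap k (𝒮 0)))) → Literature.AlgebraicGeometry.Resolution.Scheme.HasResolution V) → Summit.ResolutionOfSingularities.ResolutionOfSingularities.Theses.WeightedInvariant.WeightedThesis := by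
  intro hC hBR p hp k _ _ _ X f hs hl hq hr
  have C : ∀ e : ℕ, HypersurfaceCentreChoiceTDim p e := fun e => Classical.choice (hC p hp e)
  haveI := hs; haveI := hl; haveI := hq; haveI := hr
  exact HypersurfaceChoiceTTower.hasResolution_of_choiceTDim_field hp C
    (fun V g _ _ _ _ hV => hBR p hp k V g hV) X f

/-- **The RESHAPE 9 ladder through the tower-typed ladder**: choices in every transversal dimension (and a
fortiori one-piece choices, strategies, hypersurface data, `WeightedConstruction`) and prime-wise Bergh–Rydh
give `WeightedThesis`, factored through `(H) ⇒ (H_T)`. [folklore] -/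
theorem weightedThesis_of_hypersurfaceChoiceDim_of_forall_berghRydh_charP' :
    (∀ p : ℕ, p.Prime → ∀ e : ℕ, Nonempty (HypersurfaceCentreChoiceDim p e)) →
    (∀ p : ℕ, p.Prime → ∀ (k : Type) [Field k] [CharP k p] [PerfectField k] (V : Scheme.{0})
      (g : V ⟶ Spec (.of k)) [IsIntegral V] [IsSeparated g] [LocallyOfFiniteType g] [QuasiCompact g],
      (∀ v : V, ∃ (A : Type) (_ : AddCommGroup A) (_ : Finite A) (_ : DecidableEq A)
        (S : Type) (_ : CommRing S) (_ : Algebra k S) (𝒮 : A → Submodule k S)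
        (_ : GradedAlgebra 𝒮), Algebra.FiniteType k S ∧ Algebra.Smooth k S ∧
        ∃ φ : Spec (.of (𝒮 0)) ⟶ V, Etale φ ∧ v ∈ Set.range φ ∧
          φ ≫ g = Spec.map (CommRingCat.ofHom (algebraMap k (𝒮 0)))) →
      Scheme.HasResolution V) →
    WeightedThesis :=
  fun hC => weightedThesis_of_hypersurfaceChoiceTDim_of_forall_berghRydh_charP
    fun p hp e => HypersurfaceCentreChoiceTDim.nonempty_of_nonempty_choiceDim (hC p hp e)

end Summit.ResolutionOfSingularities.ResolutionOfSingularities.Theorems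

end
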